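import Summits.QuantumFields.YangMills.Theorems.FluctuationComparisonRegPrIntLOrganTangentJTOfCornerStability
import Summits.QuantumFields.YangMills.Theorems.FluctuationComparisonRegPrIntLOrganTangentNearStability
import HarnessLib

/-!
# Crux `FluctuationComparisonRegPrIntL` (stmt-QuantumFields-20520, rung R3), PATH-B organ — «(JT-h)sq FROM THE ROW's ONE-BOND LETTER»: the near-pair (JT-h) door
# END-TO-END from `hdisp` + cap + near room (px20 g21 ★★`hstab_corners_of_hdisp` ∘ px19 g21 ★★★`jtBracket_of_cornerStability`), DEFINITION-FREE

Cell `ym3-torus` (YM ladder rung R3 = continuum `SU(2)` Yang–Mills on the three-torus — a RUNG: NOT d = 4, NOT infinite volume, NOT a mass gap, NOT Clay).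
Width seat `ym3-torus-px19` (gen 21); DISCHARGE SPEC v1.4 §9 (sq3)∕(sq4), LEAD w3 g26 №38 (2) «`hglob` replaced by NOTHING», №42; `--kind proof --supports
stmt-QuantumFields-20520 --as helper`, count-neutral, no registry ∕ binder ∕ `Lines/` edit, default heartbeats, `autoImplicit false`.

WHAT.  ★`jtBracket_sq_of_hdisp`: THE (JT-h) CONJUNCT TEXT of the frozen row at ONE admissible square `(U V W Y; B m; B′ m′)` with the law point `Xw` A CORNER
(`Xw = U ∨ Xw = V ∨ Xw = W ∨ Xw = Y` — the near-pair edition `SpreadFibreLawHJsq` pins `Xw := Y`), FROM: the frame∕chart facts (α); the ROW's one-bond plaquette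
DISPLACEMENT text `hdisp` ((I-geo) of `OrganDischargeInputsHJ` ✓p818968 verbatim: base point in the `θ_j`-window, one bond, `‖v‖ ≤ rc·θ_j∕4`, `s ∈ [0,1]`, letters `DP`) with the
uniform cap `DP ≤ Db` and the NEAR room `24∕25·θBal_Ts + 3·(Db·rc) ≤ c·θBal_Ts`, `c < 1`; the differential curvature square clause of `h_Ts∘Φ(·,z)` on the good set (γ); crude letter +
tail (δ).  Proof: px20 g21's ★★`hstab_corners_of_hdisp` (✓`…OrganTangentNearStability`: ≤ 3 admissible moves between two corners ⟹ the four pair-local corner-stability texts)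
then ONE `exact` of ★★★`jtBracket_of_cornerStability` (✓p819158).  NO window-to-window letter `Dw`∕`hglob` anywhere (TN-HGLOB-FRAME 514ad89e: the far letter is not
dischargeable in print's frames; INSTANCE TABLE 96d7f6a7: no consumer needs it).  This is the knit-sq's (JT-h)sq line as ONE name.

HONEST FRAMING: a two-name composition over HYPOTHESIS clauses; `hdisp` ([Balaban1985Variational] Thm 1 (9)–(10), Prop 9 (190) — NOT constructed), the curvature square clause
([Balaban1987RG1] (0.22)–(0.25) — NOT constructed), the crude letter and the tail are HYPOTHESES; nothing of Bałaban's analysis is asserted or proved; `SpreadFibreLawH(J)(sq)` ∕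
`OrganDischargeInputsHJ(sq)` UNDISCHARGED; LIN″, JEN″, JVARᵘ-H″, O1ᵘ-H v2.2, S1aᴴ, S3ᴴ, S2α′, S2β, 26243, the five registered stubs, crux 20520 and `YM3TorusSU2` are NOT proved; registry
`Lines/semiclassical_s2beta.lean` 3732b7df untouched; rung R3 = SU(2) YM₃ on T³ at fixed lattice data — NOT d = 4, NOT infinite volume, NOT a mass gap, NOT Clay; the Yang–Mills
mass gap is NOT proved.  [folklore]
-/

set_option autoImplicit false

noncomputable section

namespace Summit.QuantumFields.YangMills.Theorems.OrganTangentJTSqOfHdisp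

open MeasureTheory Filter Topology Function Set
open scoped ENNReal NNReal BigOperators
open Literature.MathematicalPhysics.QuantumFieldTheory.Balaban1983to89 T3ContinuumYM3Torus T3NestedUnitLaws
  T3UnitLawDensityEML T4Continuum BalabanUVClass T3UnitScaleTilt T3LevelShift T3TiltDescent
open T4CubeChartExp (expPt)
open Summit.QuantumFields.YangMills.Theorems.FluctuationComparisonRegPrIntLRunpairOrganFibreLaw (mwCut wNum wgt)
open Summit.QuantumFields.YangMills.Theorems.OrganTangentNearStability (hstab_corners_of_hdisp)
open Summit.QuantumFields.YangMills.Theorems.OrganTangentJTOfCornerStability (jtBracket_of_cornerStability)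

/-- ★ **(JT-h)sq FROM THE ROW's ONE-BOND LETTER** — the (JT-h) bracket of the frozen row at one admissible square with the law point a corner, from the frame facts (α), the
row's `hdisp` text + uniform cap `Db` + near room `24∕25·θBal_Ts + 3·(Db·rc) ≤ c·θBal_Ts`, the curvature square clause on the good set (γ), crude letter + tail (δ)
(px20 ★★`hstab_corners_of_hdisp` ∘ px19 ★★★`jtBracket_of_cornerStability`; module docstring). [folklore] -/
theorem jtBracket_sq_of_hdisp (F : T3Family) (γ b₀ p₀ : ℝ) (j Ts : ℕ) (hjTs : j + 1 ≤ Ts)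
    (ρ ρ' : (i : ℕ) → GaugeField (F.P i) 0 ↥(Matrix.specialUnitaryGroup (Fin 2) ℂ) → ℝ)
    (hρm : Measurable (ρ Ts)) (hρ'm : Measurable (ρ' Ts))
    (hρc : ContinuousOn (ρ Ts) {U | PlaqSmall (θBal F.L γ b₀ p₀ Ts) U}) (hρ'c : ContinuousOn (ρ' Ts) {U | PlaqSmall (θBal F.L γ b₀ p₀ Ts) U})
    (hρpos : ∀ U, PlaqSmall (θBal F.L γ b₀ p₀ Ts) U → 0 < ρ Ts U ∧ 0 < ρ' Ts U)
    (hθ : 0 < θBal F.L γ b₀ p₀ Ts) (hθj : 0 < θBal F.L γ b₀ p₀ j)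
    (hχc : Continuous (mwCut F γ b₀ p₀ j Ts)) (hχ0 : ∀ U, 0 ≤ mwCut F γ b₀ p₀ j Ts U)
    (hχsupp : ∀ U, mwCut F γ b₀ p₀ j Ts U ≠ 0 → ∀ (n : ℕ) (hjn : j + 1 ≤ n) (hnK : n ≤ Ts), PlaqSmall (24 / 25 * θBal F.L γ b₀ p₀ n) (descendTo F ℰp n Ts hnK U))
    (hχpos : ∀ U, (∀ (n : ℕ) (hjn : j + 1 ≤ n) (hnK : n ≤ Ts), PlaqSmall (24 / 25 * θBal F.L γ b₀ p₀ n) (descendTo F ℰp n Ts hnK U)) → 0 < mwCut F γ b₀ p₀ j Ts U)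
    {Z : Type} [MeasurableSpace Z] (τ : Measure Z) [IsProbabilityMeasure τ]
    (Φ : GaugeField (F.P j) 0 ↥(Matrix.specialUnitaryGroup (Fin 2) ℂ) × Z → GaugeField (F.P Ts) 0 ↥(Matrix.specialUnitaryGroup (Fin 2) ℂ))
    (J : GaugeField (F.P j) 0 ↥(Matrix.specialUnitaryGroup (Fin 2) ℂ) × Z → ℝ≥0)
    (hΦm : Measurable Φ) (hJm : Measurable J) (CJ : ℝ) (hJle : ∀ V z, (J (V, z) : ℝ) ≤ CJ)
    (hpos : ∀ V, PlaqSmall (θBal F.L γ b₀ p₀ j) V →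
      0 < ∫⁻ z in {z | (∀ (n : ℕ) (hjn : j + 1 ≤ n) (hnK : n ≤ Ts), PlaqSmall (24 / 25 * θBal F.L γ b₀ p₀ n) (descendTo F ℰp n Ts hnK (Φ (V, z))))},
        (J (V, z) : ℝ≥0∞) ∂τ)
    (t : ℝ)
    -- (β′) CORNER STABILITY: the four PAIR-LOCAL square-stability texts (✓p815882's `hstab` shape) at the corners w.r.t. the law point `Xw` — HYPOTHESES here
    {rc c : ℝ} (hc : c < 1)
    -- the square and the law point
    (B B' : PBond (F.P j) 0) (m m' : Fin 3 → ℝ) (U V W Y Xw : GaugeField (F.P j) 0 ↥(Matrix.specialUnitaryGroup (Fin 2) ℂ))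
    (hm : ‖m‖ ≤ rc * (θBal F.L γ b₀ p₀ j / 4)) (hm' : ‖m'‖ ≤ rc * (θBal F.L γ b₀ p₀ j / 4))
    (hU : PlaqSmall (θBal F.L γ b₀ p₀ j / 4) U) (hV : PlaqSmall (θBal F.L γ b₀ p₀ j / 4) V) (hW : PlaqSmall (θBal F.L γ b₀ p₀ j / 4) W)
    (hY : PlaqSmall (θBal F.L γ b₀ p₀ j / 4) Y) (hXw : PlaqSmall (θBal F.L γ b₀ p₀ j / 4) Xw)
    (hVU : ∀ e, e ≠ B → V e = U e) (hVb : V B = U B * expPt m) (hWU : ∀ e, e ≠ B' → W e = U e) (hWb : W B' = U B' * expPt m')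
    (hYV : ∀ e, e ≠ B' → Y e = V e) (hYb : Y B' = V B' * expPt m')
    -- (β-sq) the ROW's one-bond displacement text `hdisp` ((I-geo) «b» verbatim), uniform cap, NEAR room `3·Db·rc`, law point a CORNER
    (Db : ℝ) (hrc0 : 0 ≤ rc) (hDb0 : 0 ≤ Db) (DP : Plaq (F.P Ts) 0 → PBond (F.P j) 0 → ℝ) (hDb : ∀ p b, DP p b ≤ Db)
    (hdisp : ∀ (z : Z) (X : GaugeField (F.P j) 0 ↥(Matrix.specialUnitaryGroup (Fin 2) ℂ)), PlaqSmall (θBal F.L γ b₀ p₀ j) X →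
      ∀ (b : PBond (F.P j) 0) (v : Fin 3 → ℝ), ‖v‖ ≤ rc * (θBal F.L γ b₀ p₀ j / 4) → ∀ s ∈ Icc (0 : ℝ) 1, ∀ p : Plaq (F.P Ts) 0,
        dist1 (GaugeField.plaqHol (Φ (update X b (X b * expPt (s • v)), z)) p)
          ≤ dist1 (GaugeField.plaqHol (Φ (X, z)) p) + DP p b * (‖v‖ / (θBal F.L γ b₀ p₀ j / 4)))
    (hroom : 24 / 25 * θBal F.L γ b₀ p₀ Ts + 3 * (Db * rc) ≤ c * θBal F.L γ b₀ p₀ Ts)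
    (hXwc : Xw = U ∨ Xw = V ∨ Xw = W ∨ Xw = Y)
    -- (γ) the curvature square clause of `h_Ts ∘ Φ(·, z)` on the good set (✓p814806's (s2) hypothesis, z-uniform letters)
    {ιP : Type*} [Fintype ιP] (kP : ιP → ιP → ℝ) (gP : ιP → ℝ) (KP : ιP → PBond (F.P j) 0 → ℝ) (KP2 : ιP → PBond (F.P j) 0 → PBond (F.P j) 0 → ℝ)
    (hk : ∀ p q, 0 ≤ kP p q) (hg : ∀ p, 0 ≤ gP p) (hKP : ∀ p b, 0 ≤ KP p b) (hKP2 : ∀ p b b', 0 ≤ KP2 p b b')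
    (Good : Set Z) (hGood : MeasurableSet Good)
    (hcurv : ∀ z ∈ Good, wgt F γ b₀ p₀ j Ts ρ ρ' τ Φ J t Xw z ≠ 0 →
      ∀ (b b' : PBond (F.P j) 0) (v v' : Fin 3 → ℝ) (X : GaugeField (F.P j) 0 ↥(Matrix.specialUnitaryGroup (Fin 2) ℂ)),
      ‖v‖ ≤ rc * (θBal F.L γ b₀ p₀ j / 4) → ‖v'‖ ≤ rc * (θBal F.L γ b₀ p₀ j / 4) → PlaqSmall (θBal F.L γ b₀ p₀ j / 4) X →
      PlaqSmall (θBal F.L γ b₀ p₀ j / 4) (update X b (X b * expPt v)) → PlaqSmall (θBal F.L γ b₀ p₀ j / 4) (update X b' (X b' * expPt v')) →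
      PlaqSmall (θBal F.L γ b₀ p₀ j / 4) (update (update X b (X b * expPt v)) b' ((update X b (X b * expPt v)) b' * expPt v')) →
      ∃ (F₂ F₁₂ : ℝ → ℝ → ℝ) (α α' γ' : ιP → ℝ → ℝ → ℝ),
        (∀ t' ∈ Icc (0 : ℝ) 1, HasDerivWithinAt
          (fun t' => (fun X' => Real.log (ρ Ts (Φ (X', z))) - Real.log (ρ' Ts (Φ (X', z))))
            (update (update X b (X b * expPt ((0 : ℝ) • v))) b' ((update X b (X b * expPt ((0 : ℝ) • v))) b' * expPt (t' • v'))))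
          (F₂ 0 t') (Icc 0 1) t') ∧
        (∀ t' ∈ Icc (0 : ℝ) 1, HasDerivWithinAt
          (fun t' => (fun X' => Real.log (ρ Ts (Φ (X', z))) - Real.log (ρ' Ts (Φ (X', z))))
            (update (update X b (X b * expPt ((1 : ℝ) • v))) b' ((update X b (X b * expPt ((1 : ℝ) • v))) b' * expPt (t' • v'))))
          (F₂ 1 t') (Icc 0 1) t') ∧
        (∀ t' ∈ Icc (0 : ℝ) 1, ∀ s ∈ Icc (0 : ℝ) 1, HasDerivWithinAt (fun s => F₂ s t') (F₁₂ s t') (Icc 0 1) s) ∧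
        (∀ p, ∀ s ∈ Icc (0 : ℝ) 1, ∀ t' ∈ Icc (0 : ℝ) 1, 0 ≤ α p s t' ∧ α p s t' ≤ KP p b * (‖v‖ / (θBal F.L γ b₀ p₀ j / 4))) ∧
        (∀ q, ∀ s ∈ Icc (0 : ℝ) 1, ∀ t' ∈ Icc (0 : ℝ) 1, 0 ≤ α' q s t' ∧ α' q s t' ≤ KP q b' * (‖v'‖ / (θBal F.L γ b₀ p₀ j / 4))) ∧
        (∀ p, ∀ s ∈ Icc (0 : ℝ) 1, ∀ t' ∈ Icc (0 : ℝ) 1,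
          0 ≤ γ' p s t' ∧ γ' p s t' ≤ KP2 p b b' * (‖v‖ / (θBal F.L γ b₀ p₀ j / 4)) * (‖v'‖ / (θBal F.L γ b₀ p₀ j / 4))) ∧
        (∀ s ∈ Icc (0 : ℝ) 1, ∀ t' ∈ Icc (0 : ℝ) 1,
          |F₁₂ s t'| ≤ ∑ p, ∑ q, α p s t' * kP p q * α' q s t' + ∑ p, gP p * γ' p s t'))
    -- (δ) crude letter on the law's support and tail of the good set
    {kB ES : ℝ} (hkB : 0 ≤ kB) (hES : 0 ≤ ES)
    (hcrude : ∀ z, wgt F γ b₀ p₀ j Ts ρ ρ' τ Φ J t Xw z ≠ 0 →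
      |(Real.log (ρ Ts (Φ (Y, z))) - Real.log (ρ' Ts (Φ (Y, z)))) - (Real.log (ρ Ts (Φ (V, z))) - Real.log (ρ' Ts (Φ (V, z))))
        - (Real.log (ρ Ts (Φ (W, z))) - Real.log (ρ' Ts (Φ (W, z)))) + (Real.log (ρ Ts (Φ (U, z))) - Real.log (ρ' Ts (Φ (U, z))))|
        ≤ kB * (‖m‖ / (θBal F.L γ b₀ p₀ j / 4)) * (‖m'‖ / (θBal F.L γ b₀ p₀ j / 4)))
    (htail : ∫ z in Goodᶜ, wgt F γ b₀ p₀ j Ts ρ ρ' τ Φ J t Xw z ∂τ ≤ ES) :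
    Integrable (fun z => (Real.log (ρ Ts (Φ (U, z))) - Real.log (ρ' Ts (Φ (U, z)))) * (wgt F γ b₀ p₀ j Ts ρ ρ' τ Φ J t) Xw z) τ ∧
    Integrable (fun z => (Real.log (ρ Ts (Φ (V, z))) - Real.log (ρ' Ts (Φ (V, z)))) * (wgt F γ b₀ p₀ j Ts ρ ρ' τ Φ J t) Xw z) τ ∧
    Integrable (fun z => (Real.log (ρ Ts (Φ (W, z))) - Real.log (ρ' Ts (Φ (W, z)))) * (wgt F γ b₀ p₀ j Ts ρ ρ' τ Φ J t) Xw z) τ ∧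
    Integrable (fun z => (Real.log (ρ Ts (Φ (Y, z))) - Real.log (ρ' Ts (Φ (Y, z)))) * (wgt F γ b₀ p₀ j Ts ρ ρ' τ Φ J t) Xw z) τ ∧
    |∫ z, ((Real.log (ρ Ts (Φ (Y, z))) - Real.log (ρ' Ts (Φ (Y, z)))) - (Real.log (ρ Ts (Φ (V, z))) - Real.log (ρ' Ts (Φ (V, z))))
      - (Real.log (ρ Ts (Φ (W, z))) - Real.log (ρ' Ts (Φ (W, z)))) + (Real.log (ρ Ts (Φ (U, z))) - Real.log (ρ' Ts (Φ (U, z)))))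
        * (wgt F γ b₀ p₀ j Ts ρ ρ' τ Φ J t) Xw z ∂τ|
      ≤ ((∑ p, ∑ q, KP p B * kP p q * KP q B' + ∑ p, gP p * KP2 p B B') + ES * kB)
        * (‖m‖ / (θBal F.L γ b₀ p₀ j / 4)) * (‖m'‖ / (θBal F.L γ b₀ p₀ j / 4)) := by
  have hst := hstab_corners_of_hdisp F γ b₀ p₀ j Ts hjTs hχsupp Φ hθj c Db rc hrc0 hDb0 DP hDb hdisp hroom
  exact jtBracket_of_cornerStability F γ b₀ p₀ j Ts hjTs ρ ρ' hρm hρ'm hρc hρ'c hρpos hθ hθj hχc hχ0 hχsupp hχpos τ Φ J hΦm hJm CJ hJle hpos t hc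
    B B' m m' U V W Y Xw hm hm' hU hV hW hY hXw hVU hVb hWU hWb hYV hYb
    (fun z hz p => hst z B B' m m' U V W Y hm hm' hU hV hW hY hVU hVb hWU hWb hYV hYb U Xw (Or.inl rfl) hXwc hz p)
    (fun z hz p => hst z B B' m m' U V W Y hm hm' hU hV hW hY hVU hVb hWU hWb hYV hYb V Xw (Or.inr (Or.inl rfl)) hXwc hz p)
    (fun z hz p => hst z B B' m m' U V W Y hm hm' hU hV hW hY hVU hVb hWU hWb hYV hYb W Xw (Or.inr (Or.inr (Or.inl rfl))) hXwc hz p)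
    (fun z hz p => hst z B B' m m' U V W Y hm hm' hU hV hW hY hVU hVb hWU hWb hYV hYb Y Xw (Or.inr (Or.inr (Or.inr rfl))) hXwc hz p)
    kP gP KP KP2 hk hg hKP hKP2 Good hGood hcurv hkB hES hcrude htail

end Summit.QuantumFields.YangMills.Theorems.OrganTangentJTSqOfHdisp

end
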